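import Summits.BirchSwinnertonDyer.BirchSwinnertonDyer.Theorems.ThetaPartnerAtTwoSignedControlAtTwoMuRealTwoTorsionPoint
import Summits.BirchSwinnertonDyer.BirchSwinnertonDyer.Theorems.KolyvaginRoadThreePTSelmerComplementAtOfMiddleExact
import HarnessLib

/-!
# Poitou–Tate duality for Selmer structures (Howard 2004 Thm. 2.1.11, both inclusions) AT `E[2]` for an elliptic curve with a
# rational `2`-torsion point — every number field, real places included

Route `ThetaPartnerAtTwo`, crux K4 `SignedControlAtTwo` (stmt-BirchSwinnertonDyer-20309), line `eulerchar`, lead `bsd-wall-tp2-p3` g4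
(`--supports stmt-BirchSwinnertonDyer-20309`, helper).  File 9 of the real-place packet; companion of `…MuRealSelmerComplementAt`
(μₙ, ℤ/n, order-4 modules): the `E[2]` instance, from file 6 (`middleExact_canonical_torsionGaloisModule_two_of_fixedPoint`) through
bsd-stepL koly3b's `PTAt.selmerComplementAt_canonical_of_middleExact`.

* `selmerComplementAt_canonical_torsionGaloisModule_two_of_fixedPoint` — the `SelmerComplement`-body AT `E[2]` (`W.torsionGaloisModule 2`)
  for THE canonical invariant maps at level `2`, every admissible `S`, every pair of Selmer structures `𝓕 ≤ 𝓖` unramified outside `S`,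
  for every elliptic `E/K` (any number field `K`) with a `K`-rational point of order `2` — the one place where the ∀-module named fact
  `poitouTate_selmerStructure_duality(_real) K` enters `2`-descent / Kummer-structure consumers, now a THEOREM for such curves.

HONEST FRAMING. THEOREMS ONLY; one-line packaging; per-module, not the ∀-module fact; no item closes; BSD is not proved by any of this.

References: [Howard2004HeegnerKolyvagin] Thm. 2.1.11; [MilneADT2006] I Thm. 4.10(b); [SilvermanAEC2009] III.6.4.
-/

noncomputable section

open CategoryTheory Function NumberField IsDedekindDomain
open scoped NumberField ContRepresentation

set_option linter.dupNamespace false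
set_option autoImplicit false

namespace Summit.BirchSwinnertonDyer.BirchSwinnertonDyer.Theorems.SignedEC.MuReal

open Field
open Literature.NumberTheory.GaloisRepresentations Literature.NumberTheory.GaloisCohomology
open Literature.NumberTheory.GaloisRepresentations.DiscreteGaloisModule (mu MuCarrier TateDual tateDual
  localTatePairingZMod unramifiedSubgroup SelmerStructure)
open _root_.TopRep _root_.ContRepresentation _root_.ContinuousCohomology
open Summit.BirchSwinnertonDyer.Rank1Residual.X11b.Three.Koly
open Literature.NumberTheory.EllipticCurves WeierstrassCurve

variable {K : Type} [Field K] [NumberField K]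

/-- **Howard's Thm. 2.1.11 at level `2` AT `E[2]` for an elliptic curve with a `K`-rational `2`-torsion point**, THE canonical
maps, EVERY number field (real places allowed): from `middleExact_canonical_torsionGaloisModule_two_of_fixedPoint`.  This is the
`SelmerComplement`-body at `E[2]` — the one place where the ∀-module fact `poitouTate_selmerStructure_duality(_real) K` enters the
`2`-descent / Kummer-structure consumers — now a THEOREM for such curves.
[cite: Howard2004HeegnerKolyvagin, Thm. 2.1.11 (arXiv:1202.6340 p. 6)] [cite: MilneADT2006, Ch. I, Thm. 4.10(b)] -/
theorem selmerComplementAt_canonical_torsionGaloisModule_two_of_fixedPoint [Fact (Nat.Prime 2)] (W : WeierstrassCurve K)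
    [W.IsElliptic] [Finite (geomTorsion W ((2 : ℕ) : ℤ))]
    (P : geomTorsion W ((2 : ℕ) : ℤ)) (hP0 : P ≠ 0) (hP : ∀ σ : absoluteGaloisGroup K, σ • P = P) :
    ∀ (S : Finset (Place K)),
      (∀ v : HeightOneSpectrum (𝓞 K), (Sum.inr v : Place K) ∉ S →
        ((2 : ℕ) : 𝓞 K) ∉ v.asIdeal ∧ GaloisRep.IsUnramifiedAt v (W.torsionGaloisModule ((2 : ℕ) : ℤ))) →
    ∀ (𝓕 𝓖 : SelmerStructure (W.torsionGaloisModule ((2 : ℕ) : ℤ))), 𝓕 ≤ 𝓖 → 𝓕.IsUnramifiedOutside S →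
      𝓖.IsUnramifiedOutside S →
      (∀ t : Π v : Place K, galoisCohomology ((W.torsionGaloisModule ((2 : ℕ) : ℤ)).toLocal v) 1, (∀ v ∈ S, t v ∈ 𝓖 v) →
        (∀ y ∈ ((LocalInvariants.canonical K 2).dualSelmerStructure (W.torsionGaloisModule ((2 : ℕ) : ℤ)) 𝓕).selmerGroup,
          ∑ v ∈ S, localTatePairingZMod (W.torsionGaloisModule ((2 : ℕ) : ℤ)) 2 v (LocalInvariants.canonical K 2 v) (t v)
            (galoisCohomology.localization ((W.torsionGaloisModule ((2 : ℕ) : ℤ)).tateDual 2) v 1 y) = 0) →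
        ∃ x ∈ 𝓖.selmerGroup, ∀ v ∈ S,
          galoisCohomology.localization (W.torsionGaloisModule ((2 : ℕ) : ℤ)) v 1 x - t v ∈ 𝓕 v) ∧
      (∀ u : Π v : Place K, galoisCohomology (((W.torsionGaloisModule ((2 : ℕ) : ℤ)).tateDual 2).toLocal v) 1,
        (∀ v ∈ S, u v ∈ (LocalInvariants.canonical K 2).dualSelmerStructure (W.torsionGaloisModule ((2 : ℕ) : ℤ)) 𝓕 v) →
        (∀ x ∈ 𝓖.selmerGroup,
          ∑ v ∈ S, localTatePairingZMod (W.torsionGaloisModule ((2 : ℕ) : ℤ)) 2 v (LocalInvariants.canonical K 2 v)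
            (galoisCohomology.localization (W.torsionGaloisModule ((2 : ℕ) : ℤ)) v 1 x) (u v) = 0) →
        ∃ y ∈ ((LocalInvariants.canonical K 2).dualSelmerStructure (W.torsionGaloisModule ((2 : ℕ) : ℤ)) 𝓕).selmerGroup,
          ∀ v ∈ S, galoisCohomology.localization ((W.torsionGaloisModule ((2 : ℕ) : ℤ)).tateDual 2) v 1 y - u v ∈
            (LocalInvariants.canonical K 2).dualSelmerStructure (W.torsionGaloisModule ((2 : ℕ) : ℤ)) 𝓖 v) :=
  PTAt.selmerComplementAt_canonical_of_middleExact 2 (Nat.prime_two.isPrimePow) (W.torsionGaloisModule ((2 : ℕ) : ℤ))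
    (fun Q => Subtype.ext (by
      have h := (mem_geomTorsion_iff W ((2 : ℕ) : ℤ) (Q : geomPoints W)).mp Q.2
      rw [natCast_zsmul] at h
      exact h))
    (fun _ hinf hS t horth => middleExact_canonical_torsionGaloisModule_two_of_fixedPoint W P hP0 hP hinf hS t horth)

end Summit.BirchSwinnertonDyer.BirchSwinnertonDyer.Theorems.SignedEC.MuReal

end
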